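import Literature.MathematicalPhysics.QuantumLattice.BootstrapCertificateDuality
import HarnessLib

/-!
# Bootstrap certificate duality — rectangular operators and several charge blocks

Trunk T-QLATTICE, family `hubbard`. Companion of `BootstrapCertificateDuality`: the sum-of-squares side of the
many-body-bootstrap / RDM dual (X. Han, arXiv:2006.06002 (2020), §2 — the lattice version of the matrix-model
bootstrap of Han–Hartnoll–Kruthoff, PRL 125 (2020) 041601; Kull–Schuch–Dive–Navascués,
PRX 14 (2024) 021008 §5.3) with the operators allowed to be RECTANGULAR, `O a : Matrix m n ℂ` — an operator of
charge `q` maps the `N`-particle block to the `(N+q)`-particle block, so a concrete certificate whose Gram blocks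
are indexed by charge `q ∈ {0, ±1, ±2}` is exactly a finite family of such rectangular Gram sums. Nothing numerical
is asserted; the file is pure linear algebra.

* `posSemidef_gramSum_rect`: `G ⪰ 0 ⇒ Σ_{a,b} G a b • (O a)ᴴ * O b ⪰ 0` for `O a : Matrix m n ℂ`.
* `posSemidef_gramSum_blocks`: the sum over a finite family of blocks `q` (own index set `κ q`, own codomain
  `m q`, own PSD Gram `G q`) is PSD.
* `le_groundEnergy_of_certificate_blocks`: residual `R := B - c·1 - Σ_q Σ_{a,b} G q a b • (O q a)ᴴ O q b`,
  `R + ε·1 ⪰ 0 ⇒ c - ε ≤ E₀(N)` — the form a rounded multi-block certificate instantiates.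

## References
* [Han2020Bootstrap] X. Han, *Quantum many-body bootstrap*, arXiv:2006.06002 (2020), §2 (Hubbard model, 1D and 2D).
* [HanHartnollKruthoff2020] X. Han, S. A. Hartnoll, J. Kruthoff, *Bootstrapping matrix quantum mechanics*,
  PRL 125 (2020) 041601, arXiv:2004.10212 (the matrix-model precursor; not the source of the lattice statements).
* [KullEtAl2024] I. Kull, N. Schuch, B. Dive, M. Navascués, PRX 14 (2024) 021008, arXiv:2212.03014, §5.3.
-/

noncomputable section

namespace Literature.MathematicalPhysics.QuantumLattice

open Matrix Finset
open scoped ComplexOrder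

section GramRect

variable {m n κ : Type*} [Fintype m] [Fintype n] [Fintype κ]

/-- `⟨ψ, (Oᴴ O') ψ⟩ = ⟨O ψ, O' ψ⟩` for rectangular `O O' : Matrix m n ℂ`. [folklore] -/
theorem star_dotProduct_conjTranspose_mul_mulVec_gram_rect (O O' : Matrix m n ℂ) (ψ : n → ℂ) :
    star ψ ⬝ᵥ (Oᴴ * O') *ᵥ ψ = star (O *ᵥ ψ) ⬝ᵥ (O' *ᵥ ψ) := by
  rw [star_mulVec, ← mulVec_mulVec, dotProduct_mulVec]

/-- Quadratic form of a rectangular Gram sum as a sum over the codomain of quadratic forms of `G`. [folklore] -/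
theorem star_dotProduct_gramSum_mulVec_rect (O : κ → Matrix m n ℂ) (G : Matrix κ κ ℂ) (ψ : n → ℂ) :
    star ψ ⬝ᵥ (∑ a, ∑ b, G a b • ((O a)ᴴ * O b)) *ᵥ ψ =
        ∑ s, star (fun a => (O a *ᵥ ψ) s) ⬝ᵥ G *ᵥ (fun a => (O a *ᵥ ψ) s) := by
  simp only [sum_mulVec, smul_mulVec, dotProduct_sum, dotProduct_smul,
    star_dotProduct_conjTranspose_mul_mulVec_gram_rect, smul_eq_mul]
  simp only [star_dotProduct_mulVec_eq_sum]
  simp only [dotProduct, Pi.star_apply, Finset.mul_sum]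
  rw [sum_sum_sum_comm_right]
  refine Finset.sum_congr rfl fun s _ => Finset.sum_congr rfl fun a _ =>
    Finset.sum_congr rfl fun b _ => ?_
  ring

/-- **Rectangular Gram sums are PSD**: `G ⪰ 0`, `O a : Matrix m n ℂ` ⇒ `Σ_{a,b} G a b • (O a)ᴴ * O b ⪰ 0`.
[cite: Han2020Bootstrap, §2] -/
theorem posSemidef_gramSum_rect [DecidableEq n] (O : κ → Matrix m n ℂ) {G : Matrix κ κ ℂ}
    (hG : G.PosSemidef) :
    (∑ a, ∑ b, G a b • ((O a)ᴴ * O b)).PosSemidef := by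
  refine PosSemidef.of_dotProduct_mulVec_nonneg ?_ ?_
  · have hGH : ∀ a b, star (G a b) = G b a := fun a b => by
      have := congrFun (congrFun hG.1 b) a
      simpa [conjTranspose_apply] using this
    unfold IsHermitian
    rw [conjTranspose_sum]
    simp_rw [conjTranspose_sum, conjTranspose_smul, conjTranspose_mul, conjTranspose_conjTranspose, hGH]
    exact Finset.sum_comm
  · intro ψ
    rw [star_dotProduct_gramSum_mulVec_rect]
    exact Finset.sum_nonneg fun s _ => hG.dotProduct_mulVec_nonneg _

/-- **Several charge blocks.** A finite family of rectangular Gram sums, each with its own PSD Gram matrix,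
sums to a PSD operator. [cite: Han2020Bootstrap, §2] -/
theorem posSemidef_gramSum_blocks [DecidableEq n] {Q : Type*} [Fintype Q]
    {κ : Q → Type*} [∀ q, Fintype (κ q)] {m : Q → Type*} [∀ q, Fintype (m q)]
    (O : (q : Q) → κ q → Matrix (m q) n ℂ) {G : (q : Q) → Matrix (κ q) (κ q) ℂ}
    (hG : ∀ q, (G q).PosSemidef) :
    (∑ q, ∑ a, ∑ b, G q a b • ((O q a)ᴴ * O q b)).PosSemidef := by
  classical
  have key : ∀ S : Finset Q, (∑ q ∈ S, ∑ a, ∑ b, G q a b • ((O q a)ᴴ * O q b)).PosSemidef := by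
    intro S
    induction S using Finset.induction_on with
    | empty => simpa using (PosSemidef.zero : (0 : Matrix n n ℂ).PosSemidef)
    | insert q S hq ih =>
      rw [Finset.sum_insert hq]
      exact (posSemidef_gramSum_rect (O _) (hG _)).add ih
  exact key Finset.univ

end GramRect

section Sector

variable {ι : Type*} [LinearOrder ι] [Fintype ι]

/-- **Rounded multi-block certificate ⇒ lower bound.** `B` the `N`-particle block of `H`; for each charge block
`q`, operators `O q a` from the block to some codomain `m q` and a PSD Gram `G q`; residual
`R := B - c·1 - Σ_q Σ_{a,b} G q a b • (O q a)ᴴ O q b`. If `R + ε·1 ⪰ 0` then `c - ε ≤ E₀(N)`.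
[cite: KullEtAl2024, §5.3] -/
theorem le_groundEnergy_of_certificate_blocks (H : Matrix (Finset ι) (Finset ι) ℂ) {N : ℕ}
    (hN : N ≤ Fintype.card ι) {Q : Type*} [Fintype Q]
    {κ : Q → Type*} [∀ q, Fintype (κ q)] {m : Q → Type*} [∀ q, Fintype (m q)]
    (O : (q : Q) → κ q → Matrix (m q) {s : Finset ι // s.card = N} ℂ)
    {G : (q : Q) → Matrix (κ q) (κ q) ℂ} (hG : ∀ q, (G q).PosSemidef) {c ε : ℝ}
    (hR : (H.toBlock (fun s : Finset ι => s.card = N) (fun s : Finset ι => s.card = N) - (c : ℂ) • 1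
        - ∑ q, ∑ a, ∑ b, G q a b • ((O q a)ᴴ * O q b) + (ε : ℂ) • 1).PosSemidef) :
    c - ε ≤ Literature.MathematicalPhysics.QuantumLattice.groundEnergy H N := by
  refine le_groundEnergy_of_sectorBlock_posSemidef H hN ?_
  have h := hR.add (posSemidef_gramSum_blocks O hG)
  convert h using 1
  rw [Complex.ofReal_sub, sub_smul]
  abel

end Sector

end Literature.MathematicalPhysics.QuantumLattice

end
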